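import Summits.HodgeConjecture.HodgeConjecture.Theorems.F0P3bPNullGeneration
import Mathlib.Analysis.InnerProductSpace.Orthogonal
import HarnessLib

/-!
# FLOOR-0 P2a — S2⁺ piece L2c: the `𝔤`-span of a `𝔭`-null core is orthogonal to an equal-weight vector
# («ordered products + `z₀`-weights»)

Cell hodgecm-mathlib (D-0151; human ruling D-0183, FLOOR 0), crux item H413 = stmt-HodgeConjecture-24833, programme P2a (B4-archimedean
desk), line of record `Cruxes/H413/Lines/F0_P2aCohIsotypicLine.lean`, stub S2⁺ `stub_archOrth_hol : ArchOrthHolType`, reference chain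
`L2a → L2b → L2c → L2d → L2e` (PLAN-P2a v3 §2; desk ruling v3 (3c)).  THIS FILE = L2c, datum-free.  Author A-p08 (g15).  PROOF lane
(theorems only; no `def`, no instance, no notation, no named fact, no `sorry`); `--supports stmt-HodgeConjecture-24833 --as helper`.
HC_CM is proved only modulo the 7 printed citations until rung 0 closes; this file proves nothing about them.

ENGINE (imported, not rebuilt): F0P3-p01 (g2)'s ★ `Theorems/F0P3bPPartOperators` (`pPart`, `pOp ρ𝔤 c X = ρ𝔤 X + c·ρ𝔤 ⁅z₀, X⁆`) and
`Theorems/F0P3bPNullGeneration` (`grade ρ𝔤 μ E n`: `G₀ = E`, `G_{n+1} = Σ_s pOp (−μ) x_s · G_n`; `gen = ⨆_n G_n`; `lie_mem_grade`,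
`pOp_mem_grade`, `z0_apply_of_mem_grade`), typed over a bare real Lie homomorphism `ρ𝔤 : 𝔲(α, β) →ₗ⁅ℝ⁆ End_ℂ W` — no `K`-action, no
unitarity, no admissibility.

THE STATEMENT ([BorelWallach2000, II §4.1]; [HarishChandraTAMS1953, §9]; the `z₀`-weight bookkeeping of [Borel1997, 11.12 (2)]).  `W` a complex
vector space with `ρ𝔤 : 𝔲(α,β) →ₗ⁅ℝ⁆ End_ℂ W`; `μ² = −1`; `E ≤ W` a NULL CORE: `pOp μ x_s` kills `E` (`hEn`, the Cauchy–Riemann ∕ `𝔭^{−δ}`-nullity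
form) and `E` is `𝔨`-stable (`hEk`), of `z₀`-weight `w` (`hw`); a linear CLASS MAP `T : W →ₗ[ℂ] H` into a complex inner-product space with
`ρ𝔤 z₀` SKEW for the pulled-back pairing (`hskew : ⟪T (z₀ a), T b⟫ = −⟪T a, T (z₀ b)⟫`, integration by parts ★ `inner_lieDeriv_toLp_left`); a
vector `b ∈ W` of the SAME weight `w` with `⟪T E, T b⟫ = 0` (the L2a input).  THEN `⟪T v, T b⟫ = 0` for every `v` in `gen ρ𝔤 μ E`, and `gen ρ𝔤 μ E`
is the SMALLEST `ρ𝔤`-stable subspace containing `E` (`= U(𝔤)·E`).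

WEIGHT ELEMENT.  All weight statements are for a general `h ∈ 𝔲(α,β)` with `⁅h, ·⁆ = r • ⁅z₀, ·⁆`, `r ≠ 0` (`h = z₀`: `r = 1`; the cut's
`h₀ = i·J = 2 z₀ − i·1`: `r = 2`), so no eigen-hypothesis for the centre is ever needed.

THE PROOF.  §1 `gen` is `ρ𝔤`-stable (`ρ x_s = ½(P + N)(x_s)`, `𝔤 = 𝔨 + Σ_s ℝ x_s`; the `𝔤`-half of F0P3-p01's `isGKSubmodule_gen`, `K`-free)
and minimal (`P(x_s) = ρ x_s − μ ρ(J x_s)` preserves every `ρ𝔤`-stable subspace).  §2 a skew operator pairs eigenvectors of eigenvalues `κ, κ'`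
to zero unless `conj κ + κ' = 0`; for `v ∈ G_n` (`n ≥ 1`) the eigenvalue is `w + nμ` and `Im (conj(w + nμ) + w) = −n·Im μ ≠ 0` (`μ = ±i`) —
no hypothesis on `w`; `n = 0` is the input.  §4 each `G_n` is finite-dimensional, `𝔨`-stable and stable under the pair Laplacians
`ρX ρX + ρ(JX) ρ(JX) = ½(PN + NP)` (`X ∈ 𝔭`), so `gen` is exhausted by such pieces (Nelson's input, L2d).  §5 assembly over `gen = ⨆_n G_n`.

## References
* [BorelWallach2000] A. Borel, N. Wallach, *Continuous cohomology, discrete subgroups, and representations of reductive groups*, 2nd ed.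
  (2000), II §4.1 (the `𝔭^±`-grading of the `(𝔤, K)`-module generated by a `𝔭⁻`-null `K`-type; `z₀`-weights).
* [Borel1997] A. Borel, *Automorphic forms on SL₂(ℝ)* (1997), 11.12 (2) (`(Xφ, ψ) = −(φ, Xψ)` on smooth square-integrable vectors).
* [HarishChandraTAMS1953] Harish-Chandra, *Representations of a semisimple Lie group on a Banach space. I*, Trans. AMS 75 (1953), §9.
-/

-- Mathlib idiom (as in the engine files): commutator bracket on `Module.End`
attribute [local instance 100] LieRing.ofAssociativeRing

set_option autoImplicit false
set_option linter.dupNamespace false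

noncomputable section

namespace Summit.HodgeConjecture.HodgeConjecture.Cruxes.H413.F0P2aL2cPNullSpanOrthogonal

open scoped InnerProductSpace ComplexConjugate
open Literature.RepresentationTheory.BorelWallach2000
open Literature.RepresentationTheory.KonnoKonno2007 Literature.RepresentationTheory.KonnoKonno2007.RealDualPair
open Literature.RepresentationTheory.KonnoKonno2007.RealDualPair.UForm
open Summit.HodgeConjecture.HodgeConjecture.Cruxes.H413.F0P3bPPartOperators
open Summit.HodgeConjecture.HodgeConjecture.Cruxes.H413.F0P3bPNullGeneration

variable {α β : Type} [Fintype α] [DecidableEq α] [Fintype β] [DecidableEq β]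
variable {W : Type} [AddCommGroup W] [Module ℂ W] {ρ𝔤 : (uFormGroup α β).lie →ₗ⁅ℝ⁆ Module.End ℂ W}

/-! ## §1 The generated subspace `gen` is `ρ𝔤`-stable and minimal -/

section Span

/-- Induction over `gen = ⨆_n G_n` (a predicate closed under `0`, `+` and true on every `G_n` holds on `gen`). [folklore] -/
private theorem gen_induction {μ : ℂ} {E : Submodule ℂ W} {v : W} (hv : v ∈ gen ρ𝔤 μ E) (P : W → Prop)
    (hmem : ∀ n, ∀ u ∈ grade ρ𝔤 μ E n, P u) (h0 : P 0) (hadd : ∀ x y, P x → P y → P (x + y)) : P v :=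
  Submodule.iSup_induction _ (motive := P) hv hmem h0 hadd

/-- **`gen` is `ρ𝔤`-stable** for a null core `E` (`pOp μ`-null and `𝔨`-stable): `ρ𝔤 X` maps `gen ρ𝔤 μ E` into itself for EVERY
`X ∈ 𝔲(α, β)` — the `𝔤`-half of F0P3-p01's `isGKSubmodule_gen`, with no `K`-action (`𝔤 = 𝔨 + Σ_s ℝ x_s`, `ρ x_s = ½ (P + N)(x_s)`,
`P G_n ⊆ G_{n+1}`, `N G_{n+1} ⊆ G_n`, `N G₀ = 0`). [cite: BorelWallach2000, II §4.1] -/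
theorem lie_mem_gen {μ : ℂ} {E : Submodule ℂ W} (hEn : ∀ e ∈ E, ∀ s : (α × β) × Fin 2, pOp ρ𝔤 μ (upqPBasis s) e = 0)
    (hEk : ∀ Y ∈ (uFormGroup α β).kInLie, ∀ e ∈ E, ρ𝔤 Y e ∈ E) (X : (uFormGroup α β).lie) {v : W}
    (hv : v ∈ gen ρ𝔤 μ E) : ρ𝔤 X v ∈ gen ρ𝔤 μ E := by
  obtain ⟨Y, hY, c, rfl⟩ := upq_exists_kInLie_add_sum_upqPBasis X
  -- `𝔨`-part
  have hk : ρ𝔤 Y v ∈ gen ρ𝔤 μ E :=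
    gen_induction hv (fun v => ρ𝔤 Y v ∈ gen ρ𝔤 μ E) (fun n u hu => grade_le_gen μ E n (lie_mem_grade hEk Y hY n hu))
      (by rw [map_zero]; exact Submodule.zero_mem _) fun x y hx hy => by
        rw [map_add]; exact Submodule.add_mem _ hx hy
  -- frame part: `ρ x_s = ½ (P + N)(x_s)`
  have hP : ∀ s, pOp ρ𝔤 (-μ) (upqPBasis s) v ∈ gen ρ𝔤 μ E := fun s =>
    gen_induction hv (fun v => pOp ρ𝔤 (-μ) (upqPBasis s) v ∈ gen ρ𝔤 μ E)
      (fun n u hu => grade_le_gen μ E (n + 1) (pOp_upqPBasis_mem_grade_succ μ E n s hu))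
      (by rw [map_zero]; exact Submodule.zero_mem _) fun x y hx hy => by
        rw [map_add]; exact Submodule.add_mem _ hx hy
  have hN : ∀ s, pOp ρ𝔤 μ (upqPBasis s) v ∈ gen ρ𝔤 μ E := fun s =>
    gen_induction hv (fun v => pOp ρ𝔤 μ (upqPBasis s) v ∈ gen ρ𝔤 μ E)
      (fun n u hu => by
        cases n with
        | zero =>
          rw [grade_zero] at hu
          rw [hEn u hu s]; exact Submodule.zero_mem _
        | succ n => exact grade_le_gen μ E n (pOp_mem_grade hEn hEk n hu _ (upqPBasis_mem_pPart s)))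
      (by rw [map_zero]; exact Submodule.zero_mem _) fun x y hx hy => by
        rw [map_add]; exact Submodule.add_mem _ hx hy
  have hx : ∀ s, ρ𝔤 (upqPBasis s) v = (2⁻¹ : ℂ) • (pOp ρ𝔤 (-μ) (upqPBasis s) v + pOp ρ𝔤 μ (upqPBasis s) v) := by
    intro s
    rw [pOp_neg_add_pOp, smul_smul, inv_mul_cancel₀ two_ne_zero, one_smul]
  rw [map_add, LinearMap.add_apply, map_sum, LinearMap.sum_apply]
  refine Submodule.add_mem _ hk (Submodule.sum_mem _ fun s _ => ?_)
  rw [map_smul, LinearMap.smul_apply, hx, ← Complex.coe_smul]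
  exact Submodule.smul_mem _ _ (Submodule.smul_mem _ _ (Submodule.add_mem _ (hP s) (hN s)))

/-- **Every graded piece lies in every `ρ𝔤`-stable subspace containing `E`** (`P(x_s) = ρ x_s − μ ρ(⁅z₀, x_s⁆)` preserves it). [folklore] -/
theorem grade_le_of_stable (μ : ℂ) {E S : Submodule ℂ W} (hES : E ≤ S) (hS : ∀ (X : (uFormGroup α β).lie), ∀ v ∈ S, ρ𝔤 X v ∈ S) :
    ∀ n : ℕ, grade ρ𝔤 μ E n ≤ S := by
  intro n
  induction n with
  | zero => rw [grade_zero]; exact hES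
  | succ n ih =>
    rw [grade_succ]
    refine iSup_le fun s => Submodule.map_le_iff_le_comap.2 fun v hv => ?_
    rw [Submodule.mem_comap, pOp_apply]
    exact Submodule.add_mem _ (hS _ v (ih hv)) (Submodule.smul_mem _ _ (hS _ v (ih hv)))

/-- **Minimality**: `gen ρ𝔤 μ E ≤ S` for every `ρ𝔤`-stable subspace `S ⊇ E`. [folklore] -/
theorem gen_le_of_stable (μ : ℂ) {E S : Submodule ℂ W} (hES : E ≤ S) (hS : ∀ (X : (uFormGroup α β).lie), ∀ v ∈ S, ρ𝔤 X v ∈ S) :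
    gen ρ𝔤 μ E ≤ S :=
  iSup_le (grade_le_of_stable μ hES hS)

/-- **`gen ρ𝔤 μ E = U(𝔤)·E`**: for a null core, the generated subspace is the smallest `ρ𝔤`-stable subspace containing `E`.
[cite: BorelWallach2000, II §4.1] -/
theorem gen_eq_sInf {μ : ℂ} {E : Submodule ℂ W} (hEn : ∀ e ∈ E, ∀ s : (α × β) × Fin 2, pOp ρ𝔤 μ (upqPBasis s) e = 0)
    (hEk : ∀ Y ∈ (uFormGroup α β).kInLie, ∀ e ∈ E, ρ𝔤 Y e ∈ E) :
    gen ρ𝔤 μ E = sInf {S : Submodule ℂ W | E ≤ S ∧ ∀ (X : (uFormGroup α β).lie), ∀ v ∈ S, ρ𝔤 X v ∈ S} := by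
  refine le_antisymm (le_sInf fun S hS => gen_le_of_stable μ hS.1 hS.2) (sInf_le ?_)
  exact ⟨le_gen μ E, fun X v hv => lie_mem_gen hEn hEk X hv⟩

end Span

/-! ## §2 A weight element `h` with `ad h = r · ad z₀` (e.g. `h = z₀`, `r = 1`; `h = i·D = 2 z₀ − i·1`, `r = 2`): the graded pieces
are `ρ𝔤 h`-eigenspaces -/

section Weights

/-- **`[ρh, pOp c X] = −(r c) · pOp c X`** for `X ∈ 𝔭`, `c² = −1`, when `⁅h, Y⁆ = r • ⁅z₀, Y⁆` for all `Y` (so `h − r z₀` is central):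
the raising operator `pOp (−μ) X` shifts the `ρ𝔤 h`-weight by `r μ`. [cite: BorelWallach2000, II §4.1] -/
theorem weight_pOp_apply {h : (uFormGroup α β).lie} {r : ℝ} (hh : ∀ Y : (uFormGroup α β).lie, ⁅h, Y⁆ = r • ⁅upqZ0 α β, Y⁆)
    {c : ℂ} (hc : c * c = -1) (X : (uFormGroup α β).lie) (hX : X ∈ pPart α β) (v : W) :
    ρ𝔤 h (pOp ρ𝔤 c X v) = pOp ρ𝔤 c X (ρ𝔤 h v) - ((r : ℂ) * c) • pOp ρ𝔤 c X v := by
  rw [mem_pPart_iff] at hX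
  have hcomm : ∀ Y : (uFormGroup α β).lie, ρ𝔤 h (ρ𝔤 Y v) = ρ𝔤 Y (ρ𝔤 h v) + (r : ℂ) • ρ𝔤 ⁅upqZ0 α β, Y⁆ v := by
    intro Y
    have e := LinearMap.congr_fun (LieHom.map_lie ρ𝔤 h Y) v
    rw [hh Y, map_smul, Ring.lie_def, LinearMap.sub_apply, Module.End.mul_apply, Module.End.mul_apply,
      LinearMap.smul_apply] at e
    rw [← Complex.coe_smul] at e
    rw [e]; abel
  rw [pOp_apply, pOp_apply, map_add, map_smul, hcomm X, hcomm ⁅upqZ0 α β, X⁆, hX, map_neg, LinearMap.neg_apply]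
  have hrcc : (r : ℂ) * c * c = -(r : ℂ) := by rw [mul_assoc, hc, mul_neg, mul_one]
  simp only [smul_add, smul_neg, smul_smul]
  rw [hrcc, mul_comm c (r : ℂ), neg_smul]
  abel

/-- **The `ρ𝔤 h`-weights of the graded pieces**: if `E` has `ρ𝔤 h`-weight `w` then `G_n ⊆ eigenspace(ρ𝔤 h, w + n r μ)` (`μ² = −1`).
[cite: BorelWallach2000, II §4.1] -/
theorem weight_apply_of_mem_grade {h : (uFormGroup α β).lie} {r : ℝ} (hh : ∀ Y : (uFormGroup α β).lie, ⁅h, Y⁆ = r • ⁅upqZ0 α β, Y⁆)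
    {μ : ℂ} (hμ : μ * μ = -1) {E : Submodule ℂ W} {w : ℂ} (hw : ∀ e ∈ E, ρ𝔤 h e = w • e) :
    ∀ (n : ℕ) {v : W}, v ∈ grade ρ𝔤 μ E n → ρ𝔤 h v = (w + n * r * μ) • v := by
  intro n
  induction n with
  | zero =>
    intro v hv
    rw [Nat.cast_zero, zero_mul, zero_mul, add_zero]
    exact hw v hv
  | succ n ih =>
    intro v hv
    rw [grade_succ] at hv
    refine Submodule.iSup_induction _ (motive := fun v => ρ𝔤 h v = (w + ↑(n + 1) * r * μ) • v) hv ?_ ?_ ?_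
    · rintro s _ ⟨m, hm, rfl⟩
      have hc : (-μ) * (-μ) = -1 := by rw [neg_mul_neg, hμ]
      rw [weight_pOp_apply hh hc _ (upqPBasis_mem_pPart s), ih hm, map_smul, ← sub_smul]
      congr 1
      push_cast
      ring
    · rw [map_zero, smul_zero]
    · intro x y hx hy
      rw [map_add, hx, hy, smul_add]

end Weights

/-! ## §3 Eigenvectors of a skew operator with non-cancelling eigenvalues pair to zero under the class map -/

section Skew

variable {H : Type} [NormedAddCommGroup H] [InnerProductSpace ℂ H] (T : W →ₗ[ℂ] H)

/-- **Eigen-orthogonality**: if `Z` is skew for the pairing pulled back along `T` and `Z a = κ a`, `Z b = κ' b` with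
`conj κ + κ' ≠ 0`, then `⟪T a, T b⟫ = 0` (`conj κ ⟪Ta, Tb⟫ = ⟪T(Za), Tb⟫ = −⟪Ta, T(Zb)⟫ = −κ' ⟪Ta, Tb⟫`). [cite: Borel1997, 11.12 (2)] -/
theorem inner_map_eq_zero_of_eigen (Z : Module.End ℂ W) (hskew : ∀ a b : W, ⟪T (Z a), T b⟫_ℂ = -⟪T a, T (Z b)⟫_ℂ) {a b : W} {κ κ' : ℂ}
    (ha : Z a = κ • a) (hb : Z b = κ' • b) (hne : conj κ + κ' ≠ 0) : ⟪T a, T b⟫_ℂ = 0 := by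
  have h := hskew a b
  rw [ha, hb, map_smul, map_smul, inner_smul_left, inner_smul_right] at h
  have h' : (conj κ + κ') * ⟪T a, T b⟫_ℂ = 0 := by rw [add_mul, h, neg_add_cancel]
  exact (mul_eq_zero.1 h').resolve_left hne

omit [Fintype α] [DecidableEq α] [Fintype β] [DecidableEq β] in
/-- `μ² = −1` forces `Im μ ≠ 0` (indeed `μ = ±i`). [folklore] -/
private theorem im_ne_zero_of_mul_self {μ : ℂ} (hμ : μ * μ = -1) : μ.im ≠ 0 := by
  intro h0
  have hre := congrArg Complex.re hμ
  rw [Complex.mul_re, h0, mul_zero, sub_zero, Complex.neg_re, Complex.one_re] at hre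
  nlinarith [mul_self_nonneg μ.re]

omit [Fintype α] [DecidableEq α] [Fintype β] [DecidableEq β] in
/-- The weight arithmetic: `conj (w + n r μ) + w ≠ 0` for `n ≥ 1`, `r ≠ 0` and `μ² = −1` — its imaginary part is `−n r · Im μ` — with NO
hypothesis on `w`. [folklore] -/
theorem conj_add_ne_zero {μ : ℂ} (hμ : μ * μ = -1) (w : ℂ) {r : ℝ} (hr : r ≠ 0) {n : ℕ} (hn : n ≠ 0) :
    conj (w + n * r * μ) + w ≠ 0 := by
  intro h0
  have him := congrArg Complex.im h0
  simp only [Complex.add_im, Complex.conj_im, Complex.mul_im, Complex.mul_re, Complex.natCast_re, Complex.natCast_im,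
    Complex.ofReal_re, Complex.ofReal_im, zero_mul, mul_zero, sub_zero, add_zero, Complex.zero_im] at him
  have : ((n : ℝ) * r) * μ.im = 0 := by linarith
  rcases mul_eq_zero.1 this with h | h
  · rcases mul_eq_zero.1 h with h | h
    · exact hn (by exact_mod_cast h)
    · exact hr h
  · exact im_ne_zero_of_mul_self hμ h

/-- **The pieces `G_n`, `n ≥ 1`, are orthogonal (under `T`) to every `ρ𝔤 h`-eigenvector `b` of weight `w`** when `E` has weight `w`,
`⁅h, ·⁆ = r • ⁅z₀, ·⁆` with `r ≠ 0`, and `ρ𝔤 h` is skew: `G_n ⊆ eigenspace(w + n r μ)` and `conj(w + n r μ) + w ≠ 0`.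
[cite: BorelWallach2000, II §4.1] -/
theorem inner_map_eq_zero_of_mem_grade_succ {h : (uFormGroup α β).lie} {r : ℝ}
    (hh : ∀ Y : (uFormGroup α β).lie, ⁅h, Y⁆ = r • ⁅upqZ0 α β, Y⁆) (hr : r ≠ 0) {μ : ℂ} (hμ : μ * μ = -1) {E : Submodule ℂ W} {w : ℂ}
    (hw : ∀ e ∈ E, ρ𝔤 h e = w • e) (hskew : ∀ a b : W, ⟪T (ρ𝔤 h a), T b⟫_ℂ = -⟪T a, T (ρ𝔤 h b)⟫_ℂ) {b : W} (hb : ρ𝔤 h b = w • b)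
    (n : ℕ) {v : W} (hv : v ∈ grade ρ𝔤 μ E (n + 1)) : ⟪T v, T b⟫_ℂ = 0 :=
  inner_map_eq_zero_of_eigen T (ρ𝔤 h) hskew (weight_apply_of_mem_grade hh hμ hw (n + 1) hv) hb
    (conj_add_ne_zero hμ w hr (Nat.succ_ne_zero n))

end Skew

/-! ## §4 Exhaustion of `gen` by finite-dimensional `𝔨`- and pair-Laplacian-stable pieces (the input shape of Nelson's theorem, L2d) -/

section Exhaustion

/-- The graded pieces of a finite-dimensional core are finite-dimensional (`G_{n+1} = ⨆_s P(x_s) G_n`, finitely many `s`). [folklore] -/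
theorem finiteDimensional_grade (μ : ℂ) (E : Submodule ℂ W) [FiniteDimensional ℂ E] :
    ∀ n : ℕ, FiniteDimensional ℂ (grade ρ𝔤 μ E n) := by
  intro n
  induction n with
  | zero => rw [grade_zero]; infer_instance
  | succ n ih =>
    rw [grade_succ]
    haveI := ih
    infer_instance

/-- **The pair Laplacian through `P` and `N`**: `ρX ρX + ρ(JX) ρ(JX) = ½ (P N + N P)` with `P = pOp (−μ) X`, `N = pOp μ X`, `μ² = −1`
(`(A − μB)(A + μB) + (A + μB)(A − μB) = 2(A² − μ² B²)`). [folklore] -/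
theorem sq_add_sq_apply {μ : ℂ} (hμ : μ * μ = -1) (X : (uFormGroup α β).lie) (u : W) :
    ρ𝔤 X (ρ𝔤 X u) + ρ𝔤 ⁅upqZ0 α β, X⁆ (ρ𝔤 ⁅upqZ0 α β, X⁆ u) =
      (2⁻¹ : ℂ) • (pOp ρ𝔤 (-μ) X (pOp ρ𝔤 μ X u) + pOp ρ𝔤 μ X (pOp ρ𝔤 (-μ) X u)) := by
  have hP : pOp ρ𝔤 (-μ) X (pOp ρ𝔤 μ X u) = ρ𝔤 X (ρ𝔤 X u) + μ • ρ𝔤 X (ρ𝔤 ⁅upqZ0 α β, X⁆ u) -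
      μ • ρ𝔤 ⁅upqZ0 α β, X⁆ (ρ𝔤 X u) + ρ𝔤 ⁅upqZ0 α β, X⁆ (ρ𝔤 ⁅upqZ0 α β, X⁆ u) := by
    rw [pOp_apply, pOp_apply, map_add, map_smul, map_add, map_smul, smul_add, smul_smul, neg_mul, hμ, neg_neg, one_smul,
      neg_smul]
    abel
  have hN : pOp ρ𝔤 μ X (pOp ρ𝔤 (-μ) X u) = ρ𝔤 X (ρ𝔤 X u) - μ • ρ𝔤 X (ρ𝔤 ⁅upqZ0 α β, X⁆ u) +
      μ • ρ𝔤 ⁅upqZ0 α β, X⁆ (ρ𝔤 X u) + ρ𝔤 ⁅upqZ0 α β, X⁆ (ρ𝔤 ⁅upqZ0 α β, X⁆ u) := by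
    rw [pOp_apply, pOp_apply, map_add, map_smul, map_add, map_smul, smul_add μ, smul_smul, mul_neg, hμ, neg_neg, one_smul,
      neg_smul]
    abel
  have hsum : (ρ𝔤 X (ρ𝔤 X u) + μ • ρ𝔤 X (ρ𝔤 ⁅upqZ0 α β, X⁆ u) - μ • ρ𝔤 ⁅upqZ0 α β, X⁆ (ρ𝔤 X u) +
      ρ𝔤 ⁅upqZ0 α β, X⁆ (ρ𝔤 ⁅upqZ0 α β, X⁆ u)) + (ρ𝔤 X (ρ𝔤 X u) - μ • ρ𝔤 X (ρ𝔤 ⁅upqZ0 α β, X⁆ u) +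
      μ • ρ𝔤 ⁅upqZ0 α β, X⁆ (ρ𝔤 X u) + ρ𝔤 ⁅upqZ0 α β, X⁆ (ρ𝔤 ⁅upqZ0 α β, X⁆ u)) =
      (2 : ℂ) • (ρ𝔤 X (ρ𝔤 X u) + ρ𝔤 ⁅upqZ0 α β, X⁆ (ρ𝔤 ⁅upqZ0 α β, X⁆ u)) := by
    rw [two_smul]; abel
  rw [hP, hN, hsum, smul_smul, inv_mul_cancel₀ two_ne_zero, one_smul]

/-- **Each graded piece is stable under the pair Laplacians `ρX ρX + ρ(JX) ρ(JX)`, `X ∈ 𝔭`** (`P N G_n ⊆ P G_{n−1} ⊆ G_n`,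
`N P G_n ⊆ N G_{n+1} ⊆ G_n`). [cite: BorelWallach2000, II §4.1] -/
theorem sq_add_sq_mem_grade {μ : ℂ} (hμ : μ * μ = -1) {E : Submodule ℂ W}
    (hEn : ∀ e ∈ E, ∀ s : (α × β) × Fin 2, pOp ρ𝔤 μ (upqPBasis s) e = 0)
    (hEk : ∀ Y ∈ (uFormGroup α β).kInLie, ∀ e ∈ E, ρ𝔤 Y e ∈ E) (X : (uFormGroup α β).lie) (hX : X ∈ pPart α β)
    (n : ℕ) {u : W} (hu : u ∈ grade ρ𝔤 μ E n) :
    ρ𝔤 X (ρ𝔤 X u) + ρ𝔤 ⁅upqZ0 α β, X⁆ (ρ𝔤 ⁅upqZ0 α β, X⁆ u) ∈ grade ρ𝔤 μ E n := by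
  rw [sq_add_sq_apply hμ]
  refine Submodule.smul_mem _ _ (Submodule.add_mem _ ?_ ?_)
  · cases n with
    | zero =>
      rw [grade_zero] at hu ⊢
      rw [pOp_eq_zero_of_mem_core hEn X hX hu, map_zero]
      exact Submodule.zero_mem _
    | succ n => exact pOp_mem_grade_succ μ E n X hX (pOp_mem_grade hEn hEk n hu X hX)
  · exact pOp_mem_grade hEn hEk n (pOp_mem_grade_succ μ E n X hX hu) X hX

/-- **Exhaustion**: for a finite-dimensional null core `E`, every `v ∈ gen ρ𝔤 μ E` lies in a finite-dimensional subspace `T ≤ gen ρ𝔤 μ E`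
that is `𝔨`-stable and stable under every pair Laplacian `ρX ρX + ρ(JX) ρ(JX)`, `X ∈ 𝔭` (hence under `Δ = Σ_𝔨 Y² + Σ_b (X_b² + (JX_b)²)`
for a `𝔨`-adapted basis) — take `T = G_{n₁} + ⋯ + G_{n_k}`. [cite: BorelWallach2000, II §4.1] [cite: HarishChandraTAMS1953, §9] -/
theorem exists_finiteDimensional_stable {μ : ℂ} (hμ : μ * μ = -1) {E : Submodule ℂ W} [FiniteDimensional ℂ E]
    (hEn : ∀ e ∈ E, ∀ s : (α × β) × Fin 2, pOp ρ𝔤 μ (upqPBasis s) e = 0)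
    (hEk : ∀ Y ∈ (uFormGroup α β).kInLie, ∀ e ∈ E, ρ𝔤 Y e ∈ E) {v : W} (hv : v ∈ gen ρ𝔤 μ E) :
    ∃ T : Submodule ℂ W, v ∈ T ∧ T ≤ gen ρ𝔤 μ E ∧ FiniteDimensional ℂ T ∧
      (∀ Y ∈ (uFormGroup α β).kInLie, ∀ u ∈ T, ρ𝔤 Y u ∈ T) ∧
      (∀ X ∈ pPart α β, ∀ u ∈ T, ρ𝔤 X (ρ𝔤 X u) + ρ𝔤 ⁅upqZ0 α β, X⁆ (ρ𝔤 ⁅upqZ0 α β, X⁆ u) ∈ T) := by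
  refine gen_induction hv (fun v => ∃ T : Submodule ℂ W, v ∈ T ∧ T ≤ gen ρ𝔤 μ E ∧ FiniteDimensional ℂ T ∧
      (∀ Y ∈ (uFormGroup α β).kInLie, ∀ u ∈ T, ρ𝔤 Y u ∈ T) ∧
      (∀ X ∈ pPart α β, ∀ u ∈ T, ρ𝔤 X (ρ𝔤 X u) + ρ𝔤 ⁅upqZ0 α β, X⁆ (ρ𝔤 ⁅upqZ0 α β, X⁆ u) ∈ T)) ?_ ?_ ?_
  · intro n u hu
    exact ⟨grade ρ𝔤 μ E n, hu, grade_le_gen μ E n, finiteDimensional_grade μ E n,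
      fun Y hY u hu => lie_mem_grade hEk Y hY n hu, fun X hX u hu => sq_add_sq_mem_grade hμ hEn hEk X hX n hu⟩
  · exact ⟨⊥, Submodule.zero_mem _, bot_le, inferInstance, fun _ _ u hu => by
      rw [(Submodule.mem_bot ℂ).1 hu, map_zero]; exact Submodule.zero_mem _, fun _ _ u hu => by
      rw [(Submodule.mem_bot ℂ).1 hu, map_zero, map_zero, map_zero, map_zero, add_zero]; exact Submodule.zero_mem _⟩
  · rintro x y ⟨T, hxT, hTg, hTf, hTk, hTL⟩ ⟨T', hyT, hTg', hTf', hTk', hTL'⟩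
    haveI := hTf; haveI := hTf'
    refine ⟨T ⊔ T', Submodule.add_mem _ (Submodule.mem_sup_left hxT) (Submodule.mem_sup_right hyT), sup_le hTg hTg',
      inferInstance, fun Y hY u hu => ?_, fun X hX u hu => ?_⟩
    · obtain ⟨a, ha, c, hc, rfl⟩ := Submodule.mem_sup.1 hu
      rw [map_add]
      exact Submodule.add_mem _ (Submodule.mem_sup_left (hTk Y hY a ha)) (Submodule.mem_sup_right (hTk' Y hY c hc))
    · obtain ⟨a, ha, c, hc, rfl⟩ := Submodule.mem_sup.1 hu
      have e : ρ𝔤 X (ρ𝔤 X (a + c)) + ρ𝔤 ⁅upqZ0 α β, X⁆ (ρ𝔤 ⁅upqZ0 α β, X⁆ (a + c)) =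
          (ρ𝔤 X (ρ𝔤 X a) + ρ𝔤 ⁅upqZ0 α β, X⁆ (ρ𝔤 ⁅upqZ0 α β, X⁆ a)) +
            (ρ𝔤 X (ρ𝔤 X c) + ρ𝔤 ⁅upqZ0 α β, X⁆ (ρ𝔤 ⁅upqZ0 α β, X⁆ c)) := by
        simp only [map_add]; abel
      rw [e]
      exact Submodule.add_mem _ (Submodule.mem_sup_left (hTL X hX a ha)) (Submodule.mem_sup_right (hTL' X hX c hc))

end Exhaustion

/-! ## §5 L2c: the `𝔤`-span of a null core is orthogonal to an equal-weight vector orthogonal to the core -/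

section L2c

variable {H : Type} [NormedAddCommGroup H] [InnerProductSpace ℂ H] (T : W →ₗ[ℂ] H)

/-- **L2c (graded form).**  `W` with `ρ𝔤 : 𝔲(α,β) →ₗ⁅ℝ⁆ End_ℂ W`, `μ² = −1`, a weight element `h` (`⁅h, ·⁆ = r • ⁅z₀, ·⁆`, `r ≠ 0`),
a subspace `E` of `ρ𝔤 h`-weight `w`, a class map `T` for which `ρ𝔤 h` is skew, and `b` of weight `w` with `⟪T E, T b⟫ = 0`: then
`⟪T v, T b⟫ = 0` for all `v ∈ gen ρ𝔤 μ E` (`= U(𝔤)·E` for a null core, `gen_eq_sInf`).  The null-core hypotheses are not needed by the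
orthogonality itself. [cite: BorelWallach2000, II §4.1] [cite: Borel1997, 11.12 (2)] -/
theorem inner_map_eq_zero_of_mem_gen {h : (uFormGroup α β).lie} {r : ℝ}
    (hh : ∀ Y : (uFormGroup α β).lie, ⁅h, Y⁆ = r • ⁅upqZ0 α β, Y⁆) (hr : r ≠ 0) {μ : ℂ} (hμ : μ * μ = -1) {E : Submodule ℂ W} {w : ℂ}
    (hw : ∀ e ∈ E, ρ𝔤 h e = w • e) (hskew : ∀ a b : W, ⟪T (ρ𝔤 h a), T b⟫_ℂ = -⟪T a, T (ρ𝔤 h b)⟫_ℂ) {b : W} (hb : ρ𝔤 h b = w • b)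
    (h0 : ∀ e ∈ E, ⟪T e, T b⟫_ℂ = 0) : ∀ v ∈ gen ρ𝔤 μ E, ⟪T v, T b⟫_ℂ = 0 := by
  intro v hv
  refine Submodule.iSup_induction _ (motive := fun v => ⟪T v, T b⟫_ℂ = 0) hv (fun n u hu => ?_) ?_ ?_
  · cases n with
    | zero => rw [grade_zero] at hu; exact h0 u hu
    | succ n => exact inner_map_eq_zero_of_mem_grade_succ T hh hr hμ hw hskew hb n hu
  · rw [map_zero, inner_zero_left]
  · intro x y hx hy
    rw [map_add, inner_add_left, hx, hy, add_zero]

/-- **L2c (orthogonal-complement form)**: the `T`-image of `gen ρ𝔤 μ E` lies in the orthogonal complement of `T b`.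
[cite: BorelWallach2000, II §4.1] -/
theorem map_gen_le_orthogonal_span {h : (uFormGroup α β).lie} {r : ℝ}
    (hh : ∀ Y : (uFormGroup α β).lie, ⁅h, Y⁆ = r • ⁅upqZ0 α β, Y⁆) (hr : r ≠ 0) {μ : ℂ} (hμ : μ * μ = -1) {E : Submodule ℂ W} {w : ℂ}
    (hw : ∀ e ∈ E, ρ𝔤 h e = w • e) (hskew : ∀ a b : W, ⟪T (ρ𝔤 h a), T b⟫_ℂ = -⟪T a, T (ρ𝔤 h b)⟫_ℂ) {b : W} (hb : ρ𝔤 h b = w • b)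
    (h0 : ∀ e ∈ E, ⟪T e, T b⟫_ℂ = 0) : (gen ρ𝔤 μ E).map T ≤ (ℂ ∙ T b)ᗮ := by
  rintro _ ⟨v, hv, rfl⟩
  rw [Submodule.mem_orthogonal_singleton_iff_inner_left]
  exact inner_map_eq_zero_of_mem_gen T hh hr hμ hw hskew hb h0 v hv

/-- **L2c (packaged for the S2⁺ cut `archOrth_hol_of : L2a → L2b → L2c → L2d → L2e`, the algebraic core of `sig_L2C`).**  Under the
hypotheses of the graded form plus the null-core hypotheses (`hEn`: `pOp μ x_s` kills `E` — the Cauchy–Riemann ∕ `𝔭^{−δ}`-annihilation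
of the holomorphic coordinate classes; `hEk`: `E` is `𝔨`-stable — the cotangent `K`-type) and `E` finite-dimensional, there is a subspace
`S` (`= gen ρ𝔤 μ E = U(𝔤)·E`) with: `E ≤ S`; `S` is `ρ𝔤`-stable; `S` is contained in every `ρ𝔤`-stable subspace containing `E`;
`⟪T v, T b⟫ = 0` on `S`; and every `v ∈ S` lies in a finite-dimensional `T' ≤ S` that is `𝔨`-stable and stable under the pair
Laplacians `ρX ρX + ρ(JX) ρ(JX)`, `X ∈ 𝔭` (the input of Nelson's theorem, L2d).
[cite: BorelWallach2000, II §4.1] [cite: Borel1997, 11.12 (2)] [cite: HarishChandraTAMS1953, §9] -/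
theorem exists_stable_orthogonal {h : (uFormGroup α β).lie} {r : ℝ}
    (hh : ∀ Y : (uFormGroup α β).lie, ⁅h, Y⁆ = r • ⁅upqZ0 α β, Y⁆) (hr : r ≠ 0) {μ : ℂ} (hμ : μ * μ = -1)
    {E : Submodule ℂ W} [FiniteDimensional ℂ E]
    (hEn : ∀ e ∈ E, ∀ s : (α × β) × Fin 2, pOp ρ𝔤 μ (upqPBasis s) e = 0)
    (hEk : ∀ Y ∈ (uFormGroup α β).kInLie, ∀ e ∈ E, ρ𝔤 Y e ∈ E) {w : ℂ} (hw : ∀ e ∈ E, ρ𝔤 h e = w • e)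
    (hskew : ∀ a b : W, ⟪T (ρ𝔤 h a), T b⟫_ℂ = -⟪T a, T (ρ𝔤 h b)⟫_ℂ) {b : W} (hb : ρ𝔤 h b = w • b)
    (h0 : ∀ e ∈ E, ⟪T e, T b⟫_ℂ = 0) :
    ∃ S : Submodule ℂ W, E ≤ S ∧ (∀ (X : (uFormGroup α β).lie), ∀ v ∈ S, ρ𝔤 X v ∈ S) ∧
      (∀ S' : Submodule ℂ W, E ≤ S' → (∀ (X : (uFormGroup α β).lie), ∀ v ∈ S', ρ𝔤 X v ∈ S') → S ≤ S') ∧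
      (∀ v ∈ S, ⟪T v, T b⟫_ℂ = 0) ∧
      (∀ v ∈ S, ∃ T' : Submodule ℂ W, v ∈ T' ∧ T' ≤ S ∧ FiniteDimensional ℂ T' ∧
        (∀ Y ∈ (uFormGroup α β).kInLie, ∀ u ∈ T', ρ𝔤 Y u ∈ T') ∧
        (∀ X ∈ pPart α β, ∀ u ∈ T', ρ𝔤 X (ρ𝔤 X u) + ρ𝔤 ⁅upqZ0 α β, X⁆ (ρ𝔤 ⁅upqZ0 α β, X⁆ u) ∈ T')) :=
  ⟨gen ρ𝔤 μ E, le_gen μ E, fun X _ hv => lie_mem_gen hEn hEk X hv, fun _ hES' hS' => gen_le_of_stable μ hES' hS',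
    inner_map_eq_zero_of_mem_gen T hh hr hμ hw hskew hb h0, fun _ hv => exists_finiteDimensional_stable hμ hEn hEk hv⟩

/-- **L2c for `h = z₀` itself** (`r = 1`). [cite: BorelWallach2000, II §4.1] -/
theorem inner_map_eq_zero_of_mem_gen_z0 {μ : ℂ} (hμ : μ * μ = -1) {E : Submodule ℂ W} {w : ℂ}
    (hw : ∀ e ∈ E, ρ𝔤 (upqZ0 α β) e = w • e)
    (hskew : ∀ a b : W, ⟪T (ρ𝔤 (upqZ0 α β) a), T b⟫_ℂ = -⟪T a, T (ρ𝔤 (upqZ0 α β) b)⟫_ℂ) {b : W} (hb : ρ𝔤 (upqZ0 α β) b = w • b)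
    (h0 : ∀ e ∈ E, ⟪T e, T b⟫_ℂ = 0) : ∀ v ∈ gen ρ𝔤 μ E, ⟪T v, T b⟫_ℂ = 0 :=
  inner_map_eq_zero_of_mem_gen T (h := upqZ0 α β) (r := 1) (fun _ => (one_smul ℝ _).symm) one_ne_zero hμ hw hskew hb h0

end L2c

end Summit.HodgeConjecture.HodgeConjecture.Cruxes.H413.F0P2aL2cPNullSpanOrthogonal

end
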